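import Mathlib
import Summits.Ventures.PercRepro.PuncturedLYMTypeLiftFamily
import Summits.Ventures.PercRepro.PuncturedLYMCoHypMain

/-!
# PercRepro — (SP) FOR THREE PAIRWISE DISJOINT 3-SETS AT LEVEL 4 ON 12 POINTS: A TYPE CERTIFICATE
(p10, gen 39)

The instance `n = 12`, `j = 4`, three pairwise disjoint members of size `3` (`3 + 3 = j + 2`: no `5`-set contains two
members) of the open MIXED-SIZE class (three or more members of size `< j`).  The rows are the `4`-sets containing no
member (#P = C(12, 4) − 3·C(9, 1) = 468, #Y = C(12, 5) = 792); `3` free point(s).  A type-symmetric flow with row sums `1/468` and column sums `1/792` is given as a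
TABLE on the type codes `a₀ + 5a₁ + 25a₂ + 125c + 625d` (`a_i` the intersection counts with the members, `c` the free
count, `d ∈ {0, 1, 2}` the member of the added point, `d = 3` the free point) — the potential (least-squares) coupling,
computed exactly (85 entries); the type equations are checked by enumeration, the lift of PuncturedLYMTypeLift gives
the flow, and gen 36's bridge gives (SP): `puncturedNMP_three_three_three_twelve`.
-/

namespace PercRepro.PuncturedLYM.Split.TypeLift.Twelve

open Finset

/-- The certificate table on type codes `a₀ + 5a₁ + 25a₂ + 125c + 625d` (`0` off the table). -/
def tbl (c : ℕ) : ℚ :=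
  if c = 12 then (1 : ℚ) / 2376 else
  if c = 32 then (1 : ℚ) / 2376 else
  if c = 36 then (164201 : ℚ) / 631762560 else
  if c = 52 then (1 : ℚ) / 2376 else
  if c = 56 then (164201 : ℚ) / 631762560 else
  if c = 60 then (35219 : ℚ) / 157940640 else
  if c = 132 then (1 : ℚ) / 2376 else
  if c = 136 then (1498151 : ℚ) / 5685863040 else
  if c = 152 then (1 : ℚ) / 2376 else
  if c = 156 then (391337 : ℚ) / 1421465760 else
  if c = 160 then (230563 : ℚ) / 947643840 else
  if c = 176 then (1498151 : ℚ) / 5685863040 else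
  if c = 180 then (230563 : ℚ) / 947643840 else
  if c = 252 then (1 : ℚ) / 2376 else
  if c = 256 then (395563 : ℚ) / 1421465760 else
  if c = 260 then (351203 : ℚ) / 1421465760 else
  if c = 276 then (395563 : ℚ) / 1421465760 else
  if c = 280 then (184247 : ℚ) / 710732880 else
  if c = 300 then (351203 : ℚ) / 1421465760 else
  if c = 376 then (14801 : ℚ) / 52646880 else
  if c = 380 then (124337 : ℚ) / 473821920 else
  if c = 400 then (124337 : ℚ) / 473821920 else
  if c = 637 then (1 : ℚ) / 2376 else
  if c = 657 then (164201 : ℚ) / 631762560 else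
  if c = 661 then (1 : ℚ) / 2376 else
  if c = 677 then (35219 : ℚ) / 157940640 else
  if c = 681 then (164201 : ℚ) / 631762560 else
  if c = 685 then (1 : ℚ) / 2376 else
  if c = 757 then (1498151 : ℚ) / 5685863040 else
  if c = 761 then (1 : ℚ) / 2376 else
  if c = 777 then (230563 : ℚ) / 947643840 else
  if c = 781 then (391337 : ℚ) / 1421465760 else
  if c = 785 then (1 : ℚ) / 2376 else
  if c = 801 then (230563 : ℚ) / 947643840 else
  if c = 805 then (1498151 : ℚ) / 5685863040 else
  if c = 877 then (351203 : ℚ) / 1421465760 else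
  if c = 881 then (395563 : ℚ) / 1421465760 else
  if c = 885 then (1 : ℚ) / 2376 else
  if c = 901 then (184247 : ℚ) / 710732880 else
  if c = 905 then (395563 : ℚ) / 1421465760 else
  if c = 925 then (351203 : ℚ) / 1421465760 else
  if c = 1001 then (124337 : ℚ) / 473821920 else
  if c = 1005 then (14801 : ℚ) / 52646880 else
  if c = 1025 then (124337 : ℚ) / 473821920 else
  if c = 1262 then (35219 : ℚ) / 157940640 else
  if c = 1282 then (164201 : ℚ) / 631762560 else
  if c = 1286 then (164201 : ℚ) / 631762560 else
  if c = 1302 then (1 : ℚ) / 2376 else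
  if c = 1306 then (1 : ℚ) / 2376 else
  if c = 1310 then (1 : ℚ) / 2376 else
  if c = 1382 then (230563 : ℚ) / 947643840 else
  if c = 1386 then (230563 : ℚ) / 947643840 else
  if c = 1402 then (1498151 : ℚ) / 5685863040 else
  if c = 1406 then (391337 : ℚ) / 1421465760 else
  if c = 1410 then (1498151 : ℚ) / 5685863040 else
  if c = 1426 then (1 : ℚ) / 2376 else
  if c = 1430 then (1 : ℚ) / 2376 else
  if c = 1502 then (351203 : ℚ) / 1421465760 else
  if c = 1506 then (184247 : ℚ) / 710732880 else
  if c = 1510 then (351203 : ℚ) / 1421465760 else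
  if c = 1526 then (395563 : ℚ) / 1421465760 else
  if c = 1530 then (395563 : ℚ) / 1421465760 else
  if c = 1550 then (1 : ℚ) / 2376 else
  if c = 1626 then (124337 : ℚ) / 473821920 else
  if c = 1630 then (124337 : ℚ) / 473821920 else
  if c = 1650 then (14801 : ℚ) / 52646880 else
  if c = 1887 then (296629 : ℚ) / 1421465760 else
  if c = 1907 then (320417 : ℚ) / 1421465760 else
  if c = 1911 then (320417 : ℚ) / 1421465760 else
  if c = 1927 then (296629 : ℚ) / 1421465760 else
  if c = 1931 then (320417 : ℚ) / 1421465760 else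
  if c = 1935 then (296629 : ℚ) / 1421465760 else
  if c = 2007 then (652451 : ℚ) / 2842931520 else
  if c = 2011 then (652451 : ℚ) / 2842931520 else
  if c = 2027 then (652451 : ℚ) / 2842931520 else
  if c = 2031 then (114883 : ℚ) / 473821920 else
  if c = 2035 then (652451 : ℚ) / 2842931520 else
  if c = 2051 then (652451 : ℚ) / 2842931520 else
  if c = 2055 then (652451 : ℚ) / 2842931520 else
  if c = 2127 then (55307 : ℚ) / 236910960 else
  if c = 2131 then (174793 : ℚ) / 710732880 else
  if c = 2135 then (55307 : ℚ) / 236910960 else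
  if c = 2151 then (174793 : ℚ) / 710732880 else
  if c = 2155 then (174793 : ℚ) / 710732880 else
  if c = 2175 then (55307 : ℚ) / 236910960 else
  0

/-- The weight read off the type `a`, the free count `c` and the direction `d` (`none` = free). -/
def W (a : Fin 3 → ℕ) (c : ℕ) (d : Option (Fin 3)) : ℚ :=
  tbl (a 0 + 5 * a 1 + 25 * a 2 + 125 * c + 625 * d.elim 3 (fun i => (i : ℕ)))

/-- An `if` with nonnegative branches is nonnegative. -/
theorem ite_nonneg' {p : Prop} [Decidable p] {a b : ℚ} (ha : 0 ≤ a) (hb : 0 ≤ b) : 0 ≤ (if p then a else b) := by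
  split_ifs <;> assumption

/-- Every table entry is nonnegative. -/
theorem tbl_nonneg (c : ℕ) : 0 ≤ tbl c := by
  unfold tbl
  iterate 85 (refine ite_nonneg' (by norm_num) ?_)
  norm_num

/-- The weights are nonnegative. -/
theorem W_nonneg (a : Fin 3 → ℕ) (c : ℕ) (d : Option (Fin 3)) : 0 ≤ W a c d := tbl_nonneg _

/-- The row equations, `a₀ = 0`. -/
theorem row_check_0 (a₁ a₂ c : ℕ) (h₁ : a₁ ≤ 2) (h₂ : a₂ ≤ 2) (hc : c ≤ 3)
    (hs : 0 + a₁ + a₂ + c = 4) :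
    ((3 - 0 : ℕ) : ℚ) * W ![0, a₁, a₂] c (some 0) + ((3 - a₁ : ℕ) : ℚ) * W ![0, a₁, a₂] c (some 1) +
      ((3 - a₂ : ℕ) : ℚ) * W ![0, a₁, a₂] c (some 2) + ((3 - c : ℕ) : ℚ) * W ![0, a₁, a₂] c none = 1 / 468 := by
  simp only [W, Option.elim, Matrix.cons_val_zero, Matrix.cons_val_one, Matrix.head_cons, Matrix.cons_val_two,
    Matrix.tail_cons, Fin.val_zero, Fin.val_one, Fin.val_two]
  interval_cases a₁ <;> interval_cases a₂ <;> interval_cases c <;> (first | omega | norm_num [tbl])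

/-- The row equations, `a₀ = 1`. -/
theorem row_check_1 (a₁ a₂ c : ℕ) (h₁ : a₁ ≤ 2) (h₂ : a₂ ≤ 2) (hc : c ≤ 3)
    (hs : 1 + a₁ + a₂ + c = 4) :
    ((3 - 1 : ℕ) : ℚ) * W ![1, a₁, a₂] c (some 0) + ((3 - a₁ : ℕ) : ℚ) * W ![1, a₁, a₂] c (some 1) +
      ((3 - a₂ : ℕ) : ℚ) * W ![1, a₁, a₂] c (some 2) + ((3 - c : ℕ) : ℚ) * W ![1, a₁, a₂] c none = 1 / 468 := by
  simp only [W, Option.elim, Matrix.cons_val_zero, Matrix.cons_val_one, Matrix.head_cons, Matrix.cons_val_two,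
    Matrix.tail_cons, Fin.val_zero, Fin.val_one, Fin.val_two]
  interval_cases a₁ <;> interval_cases a₂ <;> interval_cases c <;> (first | omega | norm_num [tbl])

/-- The row equations, `a₀ = 2`. -/
theorem row_check_2 (a₁ a₂ c : ℕ) (h₁ : a₁ ≤ 2) (h₂ : a₂ ≤ 2) (hc : c ≤ 3)
    (hs : 2 + a₁ + a₂ + c = 4) :
    ((3 - 2 : ℕ) : ℚ) * W ![2, a₁, a₂] c (some 0) + ((3 - a₁ : ℕ) : ℚ) * W ![2, a₁, a₂] c (some 1) +
      ((3 - a₂ : ℕ) : ℚ) * W ![2, a₁, a₂] c (some 2) + ((3 - c : ℕ) : ℚ) * W ![2, a₁, a₂] c none = 1 / 468 := by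
  simp only [W, Option.elim, Matrix.cons_val_zero, Matrix.cons_val_one, Matrix.head_cons, Matrix.cons_val_two,
    Matrix.tail_cons, Fin.val_zero, Fin.val_one, Fin.val_two]
  interval_cases a₁ <;> interval_cases a₂ <;> interval_cases c <;> (first | omega | norm_num [tbl])

/-- The row equations: every row type sums to `1/468`. -/
theorem row_check (a₀ a₁ a₂ c : ℕ) (h₀ : a₀ ≤ 2) (h₁ : a₁ ≤ 2) (h₂ : a₂ ≤ 2) (hc : c ≤ 3)
    (hs : a₀ + a₁ + a₂ + c = 4) :
    ((3 - a₀ : ℕ) : ℚ) * W ![a₀, a₁, a₂] c (some 0) + ((3 - a₁ : ℕ) : ℚ) * W ![a₀, a₁, a₂] c (some 1) +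
      ((3 - a₂ : ℕ) : ℚ) * W ![a₀, a₁, a₂] c (some 2) + ((3 - c : ℕ) : ℚ) * W ![a₀, a₁, a₂] c none = 1 / 468 := by
  interval_cases a₀
  · exact row_check_0 a₁ a₂ c h₁ h₂ hc hs
  · exact row_check_1 a₁ a₂ c h₁ h₂ hc hs
  · exact row_check_2 a₁ a₂ c h₁ h₂ hc hs

/-- The free-column equations, `b₀ = 0`. -/
theorem col_free_check_0 (b₁ b₂ c : ℕ) (h₁ : b₁ ≤ 2) (h₂ : b₂ ≤ 2) (hc : c ≤ 3)
    (hs : 0 + b₁ + b₂ + c = 5) :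
    (0 : ℚ) * W ![0 - 1, b₁, b₂] c (some 0) + (b₁ : ℚ) * W ![0, b₁ - 1, b₂] c (some 1) +
      (b₂ : ℚ) * W ![0, b₁, b₂ - 1] c (some 2) + (c : ℚ) * W ![0, b₁, b₂] (c - 1) none = 1 / 792 := by
  simp only [W, Option.elim, Matrix.cons_val_zero, Matrix.cons_val_one, Matrix.head_cons, Matrix.cons_val_two,
    Matrix.tail_cons, Fin.val_zero, Fin.val_one, Fin.val_two]
  interval_cases b₁ <;> interval_cases b₂ <;> interval_cases c <;> (first | omega | norm_num [tbl])

/-- The free-column equations, `b₀ = 1`. -/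
theorem col_free_check_1 (b₁ b₂ c : ℕ) (h₁ : b₁ ≤ 2) (h₂ : b₂ ≤ 2) (hc : c ≤ 3)
    (hs : 1 + b₁ + b₂ + c = 5) :
    (1 : ℚ) * W ![1 - 1, b₁, b₂] c (some 0) + (b₁ : ℚ) * W ![1, b₁ - 1, b₂] c (some 1) +
      (b₂ : ℚ) * W ![1, b₁, b₂ - 1] c (some 2) + (c : ℚ) * W ![1, b₁, b₂] (c - 1) none = 1 / 792 := by
  simp only [W, Option.elim, Matrix.cons_val_zero, Matrix.cons_val_one, Matrix.head_cons, Matrix.cons_val_two,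
    Matrix.tail_cons, Fin.val_zero, Fin.val_one, Fin.val_two]
  interval_cases b₁ <;> interval_cases b₂ <;> interval_cases c <;> (first | omega | norm_num [tbl])

/-- The free-column equations, `b₀ = 2`. -/
theorem col_free_check_2 (b₁ b₂ c : ℕ) (h₁ : b₁ ≤ 2) (h₂ : b₂ ≤ 2) (hc : c ≤ 3)
    (hs : 2 + b₁ + b₂ + c = 5) :
    (2 : ℚ) * W ![2 - 1, b₁, b₂] c (some 0) + (b₁ : ℚ) * W ![2, b₁ - 1, b₂] c (some 1) +
      (b₂ : ℚ) * W ![2, b₁, b₂ - 1] c (some 2) + (c : ℚ) * W ![2, b₁, b₂] (c - 1) none = 1 / 792 := by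
  simp only [W, Option.elim, Matrix.cons_val_zero, Matrix.cons_val_one, Matrix.head_cons, Matrix.cons_val_two,
    Matrix.tail_cons, Fin.val_zero, Fin.val_one, Fin.val_two]
  interval_cases b₁ <;> interval_cases b₂ <;> interval_cases c <;> (first | omega | norm_num [tbl])

/-- The column equations at a free column: every column type sums to `1/792`. -/
theorem col_free_check (b₀ b₁ b₂ c : ℕ) (h₀ : b₀ ≤ 2) (h₁ : b₁ ≤ 2) (h₂ : b₂ ≤ 2) (hc : c ≤ 3)
    (hs : b₀ + b₁ + b₂ + c = 5) :
    (b₀ : ℚ) * W ![b₀ - 1, b₁, b₂] c (some 0) + (b₁ : ℚ) * W ![b₀, b₁ - 1, b₂] c (some 1) +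
      (b₂ : ℚ) * W ![b₀, b₁, b₂ - 1] c (some 2) + (c : ℚ) * W ![b₀, b₁, b₂] (c - 1) none = 1 / 792 := by
  interval_cases b₀
  · exact col_free_check_0 b₁ b₂ c h₁ h₂ hc hs
  · exact col_free_check_1 b₁ b₂ c h₁ h₂ hc hs
  · exact col_free_check_2 b₁ b₂ c h₁ h₂ hc hs

/-- The member-column equations, member `0`: `3 · W = 1/792` for every adjacent row type. -/
theorem col_member_check_0 (a₀ a₁ a₂ c : ℕ) (h₀ : a₀ ≤ 2) (h₁ : a₁ ≤ 2) (h₂ : a₂ ≤ 2) (hc : c ≤ 3)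
    (hs : a₀ + a₁ + a₂ + c = 4) (hi : ![a₀, a₁, a₂] 0 = 2) :
    (3 : ℚ) * W ![a₀, a₁, a₂] c (some 0) = 1 / 792 := by
  simp only [W, Option.elim, Matrix.cons_val_zero, Matrix.cons_val_one, Matrix.head_cons, Matrix.cons_val_two,
    Matrix.tail_cons, Fin.val_zero, Fin.isValue] at hi ⊢
  interval_cases a₀ <;> interval_cases a₁ <;> interval_cases a₂ <;> interval_cases c <;>
    (first | omega | norm_num [tbl])

/-- The member-column equations, member `1`: `3 · W = 1/792` for every adjacent row type. -/
theorem col_member_check_1 (a₀ a₁ a₂ c : ℕ) (h₀ : a₀ ≤ 2) (h₁ : a₁ ≤ 2) (h₂ : a₂ ≤ 2) (hc : c ≤ 3)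
    (hs : a₀ + a₁ + a₂ + c = 4) (hi : ![a₀, a₁, a₂] 1 = 2) :
    (3 : ℚ) * W ![a₀, a₁, a₂] c (some 1) = 1 / 792 := by
  simp only [W, Option.elim, Matrix.cons_val_zero, Matrix.cons_val_one, Matrix.head_cons, Matrix.cons_val_two,
    Matrix.tail_cons, Fin.val_one, Fin.isValue] at hi ⊢
  interval_cases a₀ <;> interval_cases a₁ <;> interval_cases a₂ <;> interval_cases c <;>
    (first | omega | norm_num [tbl])

/-- The member-column equations, member `2`: `3 · W = 1/792` for every adjacent row type. -/
theorem col_member_check_2 (a₀ a₁ a₂ c : ℕ) (h₀ : a₀ ≤ 2) (h₁ : a₁ ≤ 2) (h₂ : a₂ ≤ 2) (hc : c ≤ 3)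
    (hs : a₀ + a₁ + a₂ + c = 4) (hi : ![a₀, a₁, a₂] 2 = 2) :
    (3 : ℚ) * W ![a₀, a₁, a₂] c (some 2) = 1 / 792 := by
  simp only [W, Option.elim, Matrix.cons_val_zero, Matrix.cons_val_one, Matrix.head_cons, Matrix.cons_val_two,
    Matrix.tail_cons, Fin.val_two, Fin.isValue] at hi ⊢
  interval_cases a₀ <;> interval_cases a₁ <;> interval_cases a₂ <;> interval_cases c <;>
    (first | omega | norm_num [tbl])

/-- The column equations at a member column: `3 · W = 1/792` for every adjacent row type. -/
theorem col_member_check (a₀ a₁ a₂ c : ℕ) (i₀ : Fin 3) (h₀ : a₀ ≤ 2) (h₁ : a₁ ≤ 2) (h₂ : a₂ ≤ 2) (hc : c ≤ 3)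
    (hs : a₀ + a₁ + a₂ + c = 4) (hi : ![a₀, a₁, a₂] i₀ = 2) :
    (3 : ℚ) * W ![a₀, a₁, a₂] c (some i₀) = 1 / 792 := by
  fin_cases i₀
  · exact col_member_check_0 a₀ a₁ a₂ c h₀ h₁ h₂ hc hs hi
  · exact col_member_check_1 a₀ a₁ a₂ c h₀ h₁ h₂ hc hs hi
  · exact col_member_check_2 a₀ a₁ a₂ c h₀ h₁ h₂ hc hs hi

/-! ### The checks in the `Fin 3 → ℕ` form used by the lift -/

/-- `a = ![a 0, a 1, a 2]`. -/
theorem eq_vec (a : Fin 3 → ℕ) : a = ![a 0, a 1, a 2] := by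
  funext i; fin_cases i <;> rfl

/-- `Function.update a 0 v = ![v, a 1, a 2]`. -/
theorem update_zero_eq (a : Fin 3 → ℕ) (v : ℕ) : Function.update a 0 v = ![v, a 1, a 2] := by
  funext i; fin_cases i <;> simp

/-- `Function.update a 1 v = ![a 0, v, a 2]`. -/
theorem update_one_eq (a : Fin 3 → ℕ) (v : ℕ) : Function.update a 1 v = ![a 0, v, a 2] := by
  funext i; fin_cases i <;> simp

/-- `Function.update a 2 v = ![a 0, a 1, v]`. -/
theorem update_two_eq (a : Fin 3 → ℕ) (v : ℕ) : Function.update a 2 v = ![a 0, a 1, v] := by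
  funext i; fin_cases i <;> simp

/-- The row equations for a row type given as a function. -/
theorem row_check' (a : Fin 3 → ℕ) (c : ℕ) (h₀ : a 0 ≤ 2) (h₁ : a 1 ≤ 2) (h₂ : a 2 ≤ 2) (hc : c ≤ 3)
    (hs : a 0 + a 1 + a 2 + c = 4) :
    ((3 - a 0 : ℕ) : ℚ) * W a c (some 0) + ((3 - a 1 : ℕ) : ℚ) * W a c (some 1) +
      ((3 - a 2 : ℕ) : ℚ) * W a c (some 2) + ((3 - c : ℕ) : ℚ) * W a c none = 1 / 468 := by
  have key := row_check (a 0) (a 1) (a 2) c h₀ h₁ h₂ hc hs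
  rw [← eq_vec a] at key
  exact key

/-- The free-column equations for a column type given as a function. -/
theorem col_free_check' (b : Fin 3 → ℕ) (c : ℕ) (h₀ : b 0 ≤ 2) (h₁ : b 1 ≤ 2) (h₂ : b 2 ≤ 2) (hc : c ≤ 3)
    (hs : b 0 + b 1 + b 2 + c = 5) :
    (b 0 : ℚ) * W (Function.update b 0 (b 0 - 1)) c (some 0) +
      (b 1 : ℚ) * W (Function.update b 1 (b 1 - 1)) c (some 1) +
      (b 2 : ℚ) * W (Function.update b 2 (b 2 - 1)) c (some 2) + (c : ℚ) * W b (c - 1) none = 1 / 792 := by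
  have key := col_free_check (b 0) (b 1) (b 2) c h₀ h₁ h₂ hc hs
  rw [← update_zero_eq, ← update_one_eq, ← update_two_eq, ← eq_vec b] at key
  exact key

/-- The member-column equations for a column type given as a function. -/
theorem col_member_check' (b : Fin 3 → ℕ) (c : ℕ) (i₀ : Fin 3) (hi : b i₀ = 3) (hl : ∀ l, l ≠ i₀ → b l ≤ 2)
    (hc : c ≤ 3) (hs : b 0 + b 1 + b 2 + c = 5) :
    (3 : ℚ) * W (Function.update b i₀ (b i₀ - 1)) c (some i₀) = 1 / 792 := by
  fin_cases i₀
  · simp only [Fin.zero_eta, Fin.isValue] at hi hl ⊢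
    rw [update_zero_eq, hi]
    exact col_member_check 2 (b 1) (b 2) c 0 (by norm_num) (hl 1 (by decide)) (hl 2 (by decide)) hc (by omega)
      (by simp)
  · simp only [Fin.mk_one, Fin.isValue] at hi hl ⊢
    rw [update_one_eq, hi]
    exact col_member_check (b 0) 2 (b 2) c 1 (hl 0 (by decide)) (by norm_num) (hl 2 (by decide)) hc (by omega)
      (by simp)
  · simp only [Fin.reduceFinMk, Fin.isValue] at hi hl ⊢
    rw [update_two_eq, hi]
    exact col_member_check (b 0) (b 1) 2 c 2 (hl 0 (by decide)) (hl 1 (by decide)) (by norm_num) hc (by omega)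
      (by simp)

/-! ### The theorem -/

section Main

variable {α : Type} [DecidableEq α] [Fintype α]

/-- Two of the members' up-levels are disjoint: a `4`-set contains at most one `3`-member. -/
theorem disjoint_upLevel_three (C : Fin 3 → Finset α) (hcard : ∀ i, (C i).card = 3)
    (hdisj : ∀ i l, i ≠ l → Disjoint (C i) (C l)) (i l : Fin 3) (hil : i ≠ l) :
    Disjoint (upLevel 4 (C i)) (upLevel 4 (C l)) := by
  rw [disjoint_left]
  intro X h1 h2
  rw [mem_upLevel] at h1 h2
  have := card_le_card (union_subset h1.2 h2.2)
  rw [card_union_of_disjoint (hdisj i l hil), hcard, hcard, h1.1] at this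
  omega

/-- `#P = C(12, 4) − 3·C(9, 1) = 468`. -/
theorem card_punctured_twelve (hn : Fintype.card α = 12) (C : Fin 3 → Finset α) (hcard : ∀ i, (C i).card = 3)
    (hdisj : ∀ i l, i ≠ l → Disjoint (C i) (C l)) :
    (punctured 4 ((univ : Finset (Fin 3)).biUnion (fun i => upLevel 4 (C i)))).card = 468 := by
  unfold punctured
  have hsub : (univ : Finset (Fin 3)).biUnion (fun i => upLevel 4 (C i)) ⊆ (univ : Finset α).powersetCard 4 := by
    intro X hX
    obtain ⟨i, _, hXi⟩ := mem_biUnion.1 hX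
    rw [mem_powersetCard]
    exact ⟨subset_univ X, (mem_upLevel.1 hXi).1⟩
  have hu : ∀ i, (upLevel 4 (C i)).card = 9 := by
    intro i
    rw [card_upLevel (by rw [hcard]; norm_num), hcard, hn]
    rfl
  rw [card_sdiff_of_subset hsub, card_powersetCard, card_univ, hn,
    card_biUnion (fun i _ l _ hil => disjoint_upLevel_three C hcard hdisj i l hil)]
  simp only [hu, sum_const, card_univ, Fintype.card_fin, smul_eq_mul]
  rfl

omit [DecidableEq α] in
/-- `#Y = C(12, 5) = 792`. -/
theorem card_levelAbove_twelve (hn : Fintype.card α = 12) : (levelAbove α 4).card = 792 := by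
  unfold levelAbove
  rw [card_powersetCard, card_univ, hn]
  rfl

/-- **THEOREM. (SP) for three pairwise disjoint `3`-sets at level `4` on `12` points** (the open mixed-size class:
members of size `< j`, three of them), by the type certificate. -/
theorem puncturedNMP_three_three_three_twelve (hn : Fintype.card α = 12) (C : Fin 3 → Finset α)
    (hcard : ∀ i, (C i).card = 3) (hdisj : ∀ i l, i ≠ l → Disjoint (C i) (C l)) :
    PuncturedNMP 4 ((univ : Finset (Fin 3)).biUnion (fun i => upLevel 4 (C i))) := by
  apply puncturedNMP_of_hasFlow
  rw [card_punctured_twelve hn C hcard hdisj, card_levelAbove_twelve hn]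
  have hbig : ∀ i l, i ≠ l → 4 + 2 ≤ (C i).card + (C l).card := by
    intro i l _
    rw [hcard, hcard]
  have hfree : (freeSet C).card = 3 := by
    rw [card_freeSet hdisj, hn]
    simp [hcard]
  refine hasFlow_of_typeWeights C (fun X hX => card_eq_of_mem_punctured_family hX) _ _ W
    (fun a c d => W_nonneg a c d) ?_ ?_
  · -- the rows
    intro X hX
    have hX' := mem_punctured_family.1 hX
    have h0 := typ_lt_card_of_not_subset C (hX'.2 0)
    have h1 := typ_lt_card_of_not_subset C (hX'.2 1)
    have h2 := typ_lt_card_of_not_subset C (hX'.2 2)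
    rw [hcard] at h0 h1 h2
    have hc := fc_le_card C X
    rw [hfree] at hc
    have hs := sum_typ_add_fc hdisj X
    rw [Fin.sum_univ_three, hX'.1] at hs
    rw [rowSum_eq, Fin.sum_univ_three, card_sdiff_eq_sub_typ, card_sdiff_eq_sub_typ, card_sdiff_eq_sub_typ,
      card_freeSet_sdiff, hcard, hcard, hcard, hfree]
    exact row_check' (typ C X) (fc C X) (by omega) (by omega) (by omega) hc hs
  · -- the columns
    intro Y hY
    have hYc : Y.card = 4 + 1 := (mem_cols.1 hY).2
    have hc := fc_le_card C Y
    rw [hfree] at hc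
    have hs := sum_typ_add_fc hdisj Y
    rw [Fin.sum_univ_three, hYc] at hs
    by_cases hmem : ∃ i₀, C i₀ ⊆ Y
    · obtain ⟨i₀, hi₀⟩ := hmem
      rw [colSum_eq_of_member W hdisj hbig hYc hi₀, hcard]
      have hi : typ C Y i₀ = 3 := by rw [typ_eq_card_of_subset C hi₀, hcard]
      have hl : ∀ l, l ≠ i₀ → typ C Y l ≤ 2 := by
        intro l hl
        have hnot : ¬ C l ⊆ Y := by
          intro hCl
          have := card_le_card (union_subset hCl hi₀)
          rw [card_union_of_disjoint (hdisj l i₀ hl), hcard, hcard, hYc] at this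
          omega
        have := typ_lt_card_of_not_subset C hnot
        rw [hcard] at this
        omega
      exact col_member_check' (typ C Y) (fc C Y) i₀ hi hl hc hs
    · have hmem' : ∀ i, ¬ C i ⊆ Y := fun i h => hmem ⟨i, h⟩
      rw [colSum_eq_of_free W hdisj hYc hmem', Fin.sum_univ_three]
      have h0 := typ_lt_card_of_not_subset C (hmem' 0)
      have h1 := typ_lt_card_of_not_subset C (hmem' 1)
      have h2 := typ_lt_card_of_not_subset C (hmem' 2)
      rw [hcard] at h0 h1 h2
      exact col_free_check' (typ C Y) (fc C Y) (by omega) (by omega) (by omega) hc hs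

end Main

end PercRepro.PuncturedLYM.Split.TypeLift.Twelve
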